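import Summits.Ventures.HodgeRepro2.T5LocalConjugationRestriction
import Summits.Ventures.HodgeRepro2.T5InertPlaceGlobalPackage
import Summits.Ventures.HodgeRepro2.T5QuadraticPlaceTrichotomy

/-!
# T5CMInertPlacePackage — the inert-place package in the record's own vocabulary: a CM field `E`
over its maximal totally real subfield `F = E⁺`, a place `v` of `F` inert in `E`, and the CM
conjugation as the star

Tier-5 kernel support (N3, the inert places) — p8, gen 15.  §8(d): uses an L-value-free
non-vanishing device: NO.

Mathlib's `NumberField.IsCMField E` provides `E⁺` (`maximalRealSubfield E`), `[E : E⁺] = 2` and the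
complex conjugation `IsCMField.complexConj E : E ≃ₐ[E⁺] E ≠ 1`.  With `K := E⁺`, `L := E`:
* `finrank_eq_two_cm` — `[E : E⁺] = 2`;
* `quadratic_place_trichotomy_cm` — every finite place of `E⁺` is split, inert or ramified in `E`;
* `apply_algebraMap_eq_complexConj` — **the local star is the CM conjugation**: every non-trivial
  `σ ∈ Gal(E_w / E⁺_v)` acts on the image of `E` as `complexConj E` (`T5LocalConjugationRestriction`);
* at a place `v` INERT in `E` (`v 𝒪_E = w`): `finrank_adicCompletion_eq_two`, `exists_algEquiv_ne_one`,
  `exists_isInteger_conj_mul_eq_unit_of_inert` (the norm theorem for units),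
  `exists_isotropic_of_inert`, `heckeAlgebra_mul_comm_of_inert`, `exists_dualLattice_eq_iff_of_inert`
  — the whole package of `T5InertPlaceGlobalPackage` with `(K, L) = (E⁺, E)`.

Nothing here identifies the datum's `E`, its inert places, or its hermitian space.
-/

namespace Summit.Ventures.HodgeRepro2.T5CMInertPlacePackage

open IsDedekindDomain HeightOneSpectrum NumberField

variable (E : Type*) [Field E] [NumberField E] [IsCMField E]

/-- `[E : E⁺] = 2`. -/
theorem finrank_eq_two_cm : Module.finrank (maximalRealSubfield E) E = 2 :=
  Algebra.IsQuadraticExtension.finrank_eq_two _ _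

variable (v : HeightOneSpectrum (𝓞 (maximalRealSubfield E)))

/-- Every finite place of `E⁺` is split, inert or ramified in the CM field `E`. -/
theorem quadratic_place_trichotomy_cm :
    (∃ w w' : HeightOneSpectrum (𝓞 E), w ≠ w' ∧ w.asIdeal.LiesOver v.asIdeal ∧
      w'.asIdeal.LiesOver v.asIdeal) ∨
    (∃ w : HeightOneSpectrum (𝓞 E), w.asIdeal.LiesOver v.asIdeal ∧
      (∀ w' : HeightOneSpectrum (𝓞 E), w'.asIdeal.LiesOver v.asIdeal → w' = w) ∧
      v.asIdeal.ramificationIdx' w.asIdeal = 1 ∧ v.asIdeal.inertiaDeg' w.asIdeal = 2) ∨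
    (∃ w : HeightOneSpectrum (𝓞 E), w.asIdeal.LiesOver v.asIdeal ∧
      (∀ w' : HeightOneSpectrum (𝓞 E), w'.asIdeal.LiesOver v.asIdeal → w' = w) ∧
      v.asIdeal.ramificationIdx' w.asIdeal = 2 ∧ v.asIdeal.inertiaDeg' w.asIdeal = 1) :=
  T5QuadraticPlaceTrichotomy.quadratic_place_trichotomy v (finrank_eq_two_cm E)

variable (w : HeightOneSpectrum (𝓞 E)) [w.asIdeal.LiesOver v.asIdeal]

/-- THE LOCAL STAR IS THE CM CONJUGATION: every non-trivial `σ ∈ Gal(E_w / E⁺_v)` acts on the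
image of `E` in `E_w` as `complexConj E`. -/
theorem apply_algebraMap_eq_complexConj
    (σ : w.adicCompletion E ≃ₐ[v.adicCompletion (maximalRealSubfield E)] w.adicCompletion E)
    (hσ : σ ≠ 1) (x : E) :
    σ (algebraMap E (w.adicCompletion E) x) =
      algebraMap E (w.adicCompletion E) (IsCMField.complexConj E x) :=
  T5LocalConjugationRestriction.apply_algebraMap_eq v w (finrank_eq_two_cm E) σ hσ
    (IsCMField.complexConj E) (IsCMField.complexConj_ne_one E) x

section Inert

variable (hmap : v.asIdeal.map (algebraMap (𝓞 (maximalRealSubfield E)) (𝓞 E)) = w.asIdeal)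
include hmap

/-- At a place `v` of `E⁺` inert in `E`: `[E_w : E⁺_v] = 2`. -/
theorem finrank_adicCompletion_eq_two :
    Module.finrank (v.adicCompletion (maximalRealSubfield E)) (w.adicCompletion E) = 2 :=
  T5InertGlobalPrime.finrank_adicCompletion_eq_two_of_staysPrime v w (finrank_eq_two_cm E) hmap

/-- At an inert place `E_w / E⁺_v` has a non-trivial automorphism (the local CM conjugation). -/
theorem exists_algEquiv_ne_one :
    ∃ σ : w.adicCompletion E ≃ₐ[v.adicCompletion (maximalRealSubfield E)] w.adicCompletion E,
      σ ≠ 1 :=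
  T5InertGlobalPrime.exists_algEquiv_ne_one_of_staysPrime v w (finrank_eq_two_cm E) hmap

omit [IsCMField E] in
/-- At an inert place every uniformiser of `𝒪_{E⁺_v}` stays a uniformiser of `𝒪_{E_w}`. -/
theorem irreducible_algebraMap_of_inert {ϖ : v.adicCompletionIntegers (maximalRealSubfield E)}
    (hϖ : Irreducible ϖ) :
    Irreducible (algebraMap (v.adicCompletionIntegers (maximalRealSubfield E))
      (w.adicCompletionIntegers E) ϖ) :=
  T5InertGlobalPrime.irreducible_algebraMap_of_staysPrime v w hmap hϖ

/-- THE NORM THEOREM FOR UNITS at an inert place of the CM extension: every unit of `𝒪_{E⁺_v}` is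
`σ z · z` with `z` integral in `E_w`. -/
theorem exists_isInteger_conj_mul_eq_unit_of_inert
    {ϖ : v.adicCompletionIntegers (maximalRealSubfield E)} (hϖ : Irreducible ϖ)
    (σ : w.adicCompletion E ≃ₐ[v.adicCompletion (maximalRealSubfield E)] w.adicCompletion E)
    (hσ : σ ≠ 1) (u : (v.adicCompletionIntegers (maximalRealSubfield E))ˣ) :
    ∃ z : w.adicCompletion E,
      IsLocalization.IsInteger
        (integralClosure (v.adicCompletionIntegers (maximalRealSubfield E)) (w.adicCompletion E)) z ∧
        σ z * z = algebraMap (v.adicCompletionIntegers (maximalRealSubfield E)) (w.adicCompletion E) u :=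
  T5InertPlaceGlobalPackage.exists_isInteger_conj_mul_eq_unit_of_staysPrime v w (finrank_eq_two_cm E)
    hmap hϖ σ hσ u

/-- THE ISOTROPY OF `V_v` at an inert place of the CM extension: every `σ`-hermitian `3 × 3` matrix
over `E_w` with unit determinant has a non-zero isotropic vector. -/
theorem exists_isotropic_of_inert
    {ϖ : v.adicCompletionIntegers (maximalRealSubfield E)} (hϖ : Irreducible ϖ)
    (σ : w.adicCompletion E ≃ₐ[v.adicCompletion (maximalRealSubfield E)] w.adicCompletion E)
    (hσ : σ ≠ 1) :
    letI := T5StarOfInvolution.starRingOfQuadratic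
      (T5InertGlobalPrime.finrank_adicCompletion_eq_two_of_staysPrime v w (finrank_eq_two_cm E) hmap)
      σ hσ
    ∀ {H : Matrix (Fin 3) (Fin 3) (w.adicCompletion E)}, H.IsHermitian → IsUnit H.det →
      ∃ x : Fin 3 → w.adicCompletion E, x ≠ 0 ∧ T5UnitaryGroupIsometry.sesqForm H x x = 0 :=
  T5InertPlaceGlobalPackage.exists_isotropic_of_staysPrime v w (finrank_eq_two_cm E) hmap hϖ σ hσ

/-- `H(U(H), K_H)` is commutative at an inert place of the CM extension, for every unimodular
`σ`-hermitian `H` with integral entries and inverse. -/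
theorem heckeAlgebra_mul_comm_of_inert
    {ϖ : v.adicCompletionIntegers (maximalRealSubfield E)} (hϖ : Irreducible ϖ)
    (σ : w.adicCompletion E ≃ₐ[v.adicCompletion (maximalRealSubfield E)] w.adicCompletion E)
    (hσ : σ ≠ 1) :
    letI := T5StarOfInvolution.starRingOfQuadratic
      (T5InertGlobalPrime.finrank_adicCompletion_eq_two_of_staysPrime v w (finrank_eq_two_cm E) hmap)
      σ hσ
    ∀ (H : Matrix (Fin 3) (Fin 3) (w.adicCompletion E)) (k : Type*) [Field k],
      H.IsHermitian →
      (∀ i j, IsLocalization.IsInteger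
        (integralClosure (v.adicCompletionIntegers (maximalRealSubfield E)) (w.adicCompletion E))
        (H i j)) →
      IsUnit H.det →
      (∀ i j, IsLocalization.IsInteger
        (integralClosure (v.adicCompletionIntegers (maximalRealSubfield E)) (w.adicCompletion E))
        (H⁻¹ i j)) →
      ∀ (T S : T5HeckePermutationModule.heckeAlgebra k (T5UnitaryHeckeAdjoint.hyperspecialSubgroup
        (integralClosure (v.adicCompletionIntegers (maximalRealSubfield E)) (w.adicCompletion E)) H)),
      T * S = S * T :=
  T5InertPlaceGlobalPackage.heckeAlgebra_mul_comm_of_staysPrime v w (finrank_eq_two_cm E) hmap hϖ σ hσ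

/-- (u3) at an inert place of the CM extension: `(E_w³, H)` admits a self-dual `𝒪_{E_w}`-lattice
iff `det H = a · ϖ^{2m}`, `a ∈ 𝒪_{E⁺_v}ˣ`, for every unimodular `σ`-hermitian `H`. -/
theorem exists_dualLattice_eq_iff_of_inert
    {ϖ : v.adicCompletionIntegers (maximalRealSubfield E)} (hϖ : Irreducible ϖ)
    (σ : w.adicCompletion E ≃ₐ[v.adicCompletion (maximalRealSubfield E)] w.adicCompletion E)
    (hσ : σ ≠ 1) :
    letI := T5StarOfInvolution.starRingOfQuadratic
      (T5InertGlobalPrime.finrank_adicCompletion_eq_two_of_staysPrime v w (finrank_eq_two_cm E) hmap)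
      σ hσ
    ∀ {H : Matrix (Fin 3) (Fin 3) (w.adicCompletion E)}, H.IsHermitian → IsUnit H.det →
    ((∃ Q : Matrix (Fin 3) (Fin 3) (w.adicCompletion E), IsUnit Q ∧
      T5UnitaryGroupIsometry.dualLattice (w.adicCompletionIntegers E) (Q.conjTranspose * H * Q)
        (T5UnitaryGroupIsometry.stdLattice (w.adicCompletionIntegers E)) =
      T5UnitaryGroupIsometry.stdLattice (w.adicCompletionIntegers E)) ↔
    ∃ (a : (v.adicCompletionIntegers (maximalRealSubfield E))ˣ) (m : ℤ),
      H.det = algebraMap (v.adicCompletionIntegers (maximalRealSubfield E)) (w.adicCompletion E) a *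
        algebraMap (v.adicCompletionIntegers (maximalRealSubfield E)) (w.adicCompletion E) ϖ ^ (2 * m)) :=
  T5InertPlaceGlobalPackage.exists_dualLattice_eq_iff_of_staysPrime' v w (finrank_eq_two_cm E) hmap hϖ σ hσ

end Inert

end Summit.Ventures.HodgeRepro2.T5CMInertPlacePackage
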